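import Mathlib
import HarnessLib
import Summits.HubbardSuperconductivity.HubbardSuperconductivity.Theorems.KLProgrammeKLRegimeSplitLegStaging

/-!
# K3 ENGINE package: the (c) value lane's `Q.CR`-keyed U-door `klValU P Q` — located door «(c)-HCU-QCR» (k3c2-p2 g21, KL STATUS 2026-08-28 20:44Z; registrant p1b g16
# takes the entry into the «A24∪A25(∪α1)» token-#14 re-render, pen (R269)(C)/(R270)(C)); cell gate-hubbard-kl, seat gate-hubbard-kl-p1b g16 (20437 v2 registrant lineage)

WHY.  Every stub-(c) value-lane closer of record (`klvrF_pairValueIncrement_inClass(_G)`, `stepValuesV17F2_of_residue_*`, k3c2-p2's p665114 at G11/13/14) carries the FIRST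
SMALLNESS LINE `hcU' : (P.C_W + klLegKappa·Q.CR·P.Klam³)·|U| ≤ 1/10` as a hypothesis; its only producer in the tree (`klEng_pairTolerance5_mul_le_of_le_klEngU₀4`, …DefsU4) is
keyed to `(klEngQ5 P R).CR`, while the registered token `klEngQ9c P R` (and any successor) has `CR = max (max (klEngQ7 P R).CR (klE5Raise P R)) (klE5Raise2 P R)` with the
class-#3 shares OPAQUE — so no existing U-door row yields `hcU'` at the token.  CURE (text of record, k3c2-p2's shape): ONE `min` entry in token #14,
**`klValU P Q := 1 / (10·(P.C_W + klLegKappa·Q.CR·P.Klam³) + 1)`** (a function of the package `Q`, positive whenever the tolerance constant is `≥ 0`), and the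
three-line discharge **`hcU_of_le_klValU`**: `0 ≤ P.C_W + klLegKappa·Q.CR·P.Klam³ → 0 < U → U ≤ klValU P Q → (P.C_W + klLegKappa·Q.CR·P.Klam³)·|U| ≤ 1/10`
(+ `klValTol_nonneg : P.WF → 0 ≤ Q.CR → 0 ≤ P.C_W + klLegKappa·Q.CR·P.Klam³`).  `R`-free by construction (the entry reads `P` and `Q` only).  The registrant's A25
U-door def carries `⊓ klValU P (klEngQ9c P R)` («A24∪A25») resp. `⊓ klValU P Q` at the package slot (∪α1, `…DefsU12bGQ`), with the row `…_le_klValU`.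
Definitions with bodies + three arithmetic lemmas; nothing about the model is asserted; nothing asserts (c), any stub of 20437, K3 or superconductivity.
-/

noncomputable section

namespace Summit.HubbardSuperconductivity.HubbardSuperconductivity.Theorems.EngineV8

set_option linter.dupNamespace false -- summit = problem name (single-conjunct summit), D-0017

open Real Summit.HubbardSuperconductivity.HubbardSuperconductivity.Theorems.KLRegimeSplit

/-- **`klValU P Q := 1/(10·(P.C_W + klLegKappa·Q.CR·P.Klam³) + 1)`** — the (c) value lane's `Q.CR`-keyed coupling threshold (located door «(c)-HCU-QCR»): below it the first
smallness line `(P.C_W + klLegKappa·Q.CR·P.Klam³)·|U| ≤ 1/10` holds at ANY package `Q` with a nonnegative tolerance constant. -/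
def klValU (P : SplitConsts) (Q : EngConsts) : ℝ := 1 / (10 * (P.C_W + klLegKappa * Q.CR * P.Klam ^ 3) + 1)

/-- The pair-array tolerance constant is nonnegative under `P.WF` and `0 ≤ Q.CR` (`klLegKappa = 4000`, `Klam ≥ 1`). -/
theorem klValTol_nonneg {P : SplitConsts} (hP : P.WF) {Q : EngConsts} (hQ : 0 ≤ Q.CR) : 0 ≤ P.C_W + klLegKappa * Q.CR * P.Klam ^ 3 := by
  have hκ0 : 0 ≤ klLegKappa := by unfold klLegKappa; norm_num
  have hK : 0 ≤ P.Klam := zero_le_one.trans hP.1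
  have hCW : 0 ≤ P.C_W := hP.2.1
  positivity

/-- `0 < klValU P Q` whenever the tolerance constant is nonnegative (in particular under `P.WF`, `0 ≤ Q.CR`). -/
theorem klValU_pos_of_nonneg {P : SplitConsts} {Q : EngConsts} (hD : 0 ≤ P.C_W + klLegKappa * Q.CR * P.Klam ^ 3) : 0 < klValU P Q := by
  unfold klValU; positivity

/-- `0 < klValU P Q` under `P.WF`, `0 ≤ Q.CR` (the form a token-#14 `_pos` row reads, with `Q.WF.2.1` / `klEngQ9c_CR_nonneg`). -/
theorem klValU_pos {P : SplitConsts} (hP : P.WF) {Q : EngConsts} (hQ : 0 ≤ Q.CR) : 0 < klValU P Q := klValU_pos_of_nonneg (klValTol_nonneg hP hQ)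

/-- **THE DISCHARGE** (k3c2-p2's `hcU'_of_le_klValU`): `0 ≤ D`, `0 < U ≤ klValU P Q` ⇒ `D·|U| ≤ 1/10`, `D := P.C_W + klLegKappa·Q.CR·P.Klam³`. -/
theorem hcU_of_le_klValU {P : SplitConsts} {Q : EngConsts} {U : ℝ} (hD : 0 ≤ P.C_W + klLegKappa * Q.CR * P.Klam ^ 3) (hU : 0 < U)
    (hUle : U ≤ klValU P Q) : (P.C_W + klLegKappa * Q.CR * P.Klam ^ 3) * |U| ≤ 1 / 10 := by
  set D := P.C_W + klLegKappa * Q.CR * P.Klam ^ 3 with hDdef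
  rw [abs_of_pos hU]
  have h1 : U ≤ 1 / (10 * D + 1) := hUle
  have hpos : 0 < 10 * D + 1 := by positivity
  have h2 : D * U ≤ D * (1 / (10 * D + 1)) := mul_le_mul_of_nonneg_left h1 hD
  have h3 : D * (1 / (10 * D + 1)) ≤ 1 / 10 := by
    rw [mul_one_div, div_le_div_iff₀ hpos (by norm_num : (0:ℝ) < 10)]
    nlinarith
  exact h2.trans h3

/-- The discharge under `P.WF`, `0 ≤ Q.CR` (binders as the (c) closers have them). -/
theorem hcU_of_le_klValU_wf {P : SplitConsts} (hP : P.WF) {Q : EngConsts} (hQ : 0 ≤ Q.CR) {U : ℝ} (hU : 0 < U) (hUle : U ≤ klValU P Q) :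
    (P.C_W + klLegKappa * Q.CR * P.Klam ^ 3) * |U| ≤ 1 / 10 :=
  hcU_of_le_klValU (klValTol_nonneg hP hQ) hU hUle

end Summit.HubbardSuperconductivity.HubbardSuperconductivity.Theorems.EngineV8

end
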